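import Mathlib
import HarnessLib
import Literature.Analysis.FluidPDE.AxisymmetricEuler
import Literature.Analysis.FluidPDE.SwirlTransportProofs
import Literature.Analysis.FluidPDE.VectorCalculus
import Literature.Analysis.FluidPDE.GavrilovLocalisation
import Literature.Analysis.FluidPDE.SereginSverakGradientEnergy

/-!
# Route `PoloidalWindowDoor`, crux `PoloidalWindowRigidity` (K2, stmt-NavierStokesRegularity-19708),
# line `slicesharp-screw` — STUB L2 `stub_screwKinematics` (screw kinematics of a poloidal field)

For a `C¹` vector field `u` on `ℝ³` that is POLOIDAL along `e₃` (`(curl u)₂ ≡ 0`) and invariant under the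
screw motions of pitch `κ` about the vertical axis through `c`,
`u (c + R_{κa}(y − c) + a e₃) = R_{κa} (u y)` for all `a`, `y` (`R_θ = rotZ θ`), the screw component
`θ(y) = ⟪u(y), h(y)⟫`, `h(y) = e₃ + κ J(y − c)` (`J = rotGen`, the Killing field of the screw motions) satisfies

* `Du(y)[h(y)] = κ J(u(y))` (differentiate the invariance at `a = 0`; `fderiv_screwField_eq`);
* its HORIZONTAL gradient is exactly `(−ω₁, ω₀)`, `ω = curl u` (`fderiv_screwComponent_horizontal`):
  `∂_d θ = ⟪Du d, h⟫ + κ⟪u, J d⟫`, and the infinitesimal invariance cancels everything but the horizontal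
  vorticity once `ω₂ = 0`;
* `θ` is constant on the axis `c + ℝ e₃` (`J e₃ = 0`, `R_θ e₃ = e₃`; `screwComponent_axis`).

Hence, by the mean value inequality along the horizontal segment from the axis point at the height of `y`,
a vorticity bound `‖curl u‖ ≤ B` gives `|θ(y) − θ(c)| ≤ B ‖(y − c)_h‖ ≤ B ‖y − c‖` (`stub_screwKinematics`,
the registered signature verbatim).  This is the kinematic input (L2) of the lead's assembly of the
screw-symmetric stratum `stub_screwStratum` (CENSUS-K2G §12.2 Cor. B(ii)).

WHAT THIS IS NOT: not a claim about Navier–Stokes regularity and not the open residue of K2 — elementary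
kinematics of screw-invariant poloidal fields (kernel-checked calculus), for the door route PoloidalWindowDoor
(bears_on LADDER-NS N0, rung N0-LocalTubeDoorPoloidal).
-/

noncomputable section

-- the summit and its single sub-problem share the name (CONVENTIONS §1), as in every Theorems file
set_option linter.dupNamespace false

namespace Summit.NavierStokesRegularity.NavierStokesRegularity.Theorems.PoloidalWindowDoorPoloidalWindowRigidityScrewKinematics

open Set Function Filter Topology InnerProductSpace
open scoped RealInnerProductSpace InnerProductSpace
open Literature.Analysis Literature.Analysis.FluidPDE

/-- The real inner product on `ℝ³` in coordinates. -/
theorem inner_eq_three (a b : (EuclideanSpace ℝ (Fin 3))) : ⟪a, b⟫_ℝ = a 0 * b 0 + a 1 * b 1 + a 2 * b 2 := by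
  simp only [PiLp.inner_apply, Fin.sum_univ_three, RCLike.inner_apply, conj_trivial]
  ring

/-- The curve `a ↦ R_{κ a} x` has velocity `κ J x` at `a = 0`. -/
theorem hasDerivAt_rotZ_mul_zero (κ : ℝ) (x : (EuclideanSpace ℝ (Fin 3))) :
    HasDerivAt (fun a : ℝ => rotZ (κ * a) x) (κ • rotGen x) 0 := by
  have hg : HasDerivAt (fun θ : ℝ => rotZ θ x) (rotGen x) (κ * 0) := by
    rw [mul_zero]; exact hasDerivAt_rotZ_zero x
  have hf : HasDerivAt (fun a : ℝ => κ * a) κ 0 := by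
    simpa using (hasDerivAt_id (0 : ℝ)).const_mul κ
  exact hg.scomp (0 : ℝ) hf


/-- **Infinitesimal screw invariance.** If `u` is differentiable at `y` and invariant under the screw motions of
pitch `κ` about the vertical axis through `c`, then `Du(y)[e₃ + κ J(y − c)] = κ J(u(y))` (differentiate
`a ↦ u(c + R_{κa}(y − c) + a e₃) = R_{κa} u(y)` at `a = 0`). -/
theorem fderiv_screwField_eq {u : (EuclideanSpace ℝ (Fin 3)) → (EuclideanSpace ℝ (Fin 3))} (κ : ℝ) (c : (EuclideanSpace ℝ (Fin 3)))
    (hinv : ∀ (a : ℝ) (y : (EuclideanSpace ℝ (Fin 3))), u (c + rotZ (κ * a) (y - c) + a • EuclideanSpace.single 2 (1 : ℝ)) =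
      rotZ (κ * a) (u y))
    {y : (EuclideanSpace ℝ (Fin 3))} (hd : DifferentiableAt ℝ u y) :
    fderiv ℝ u y ((EuclideanSpace.single 2 (1 : ℝ) : (EuclideanSpace ℝ (Fin 3))) + κ • rotGen (y - c)) = κ • rotGen (u y) := by
  have hγ : HasDerivAt (fun a : ℝ => c + rotZ (κ * a) (y - c) + a • (EuclideanSpace.single 2 (1 : ℝ) : (EuclideanSpace ℝ (Fin 3))))
      (κ • rotGen (y - c) + (EuclideanSpace.single 2 (1 : ℝ) : (EuclideanSpace ℝ (Fin 3)))) 0 := by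
    have h1 := hasDerivAt_rotZ_mul_zero κ (y - c)
    have h2 : HasDerivAt (fun a : ℝ => a • (EuclideanSpace.single 2 (1 : ℝ) : (EuclideanSpace ℝ (Fin 3))))
        (EuclideanSpace.single 2 (1 : ℝ) : (EuclideanSpace ℝ (Fin 3))) 0 := by
      simpa using (hasDerivAt_id (0 : ℝ)).smul_const (EuclideanSpace.single 2 (1 : ℝ) : (EuclideanSpace ℝ (Fin 3)))
    exact (h1.const_add c).add h2
  have hγ0 : c + rotZ (κ * 0) (y - c) + (0 : ℝ) • (EuclideanSpace.single 2 (1 : ℝ) : (EuclideanSpace ℝ (Fin 3))) = y := by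
    rw [mul_zero, rotZ_zero, zero_smul, add_zero, add_sub_cancel]
  have hu' : HasFDerivAt u (fderiv ℝ u y)
      (c + rotZ (κ * 0) (y - c) + (0 : ℝ) • (EuclideanSpace.single 2 (1 : ℝ) : (EuclideanSpace ℝ (Fin 3)))) := by
    rw [hγ0]; exact hd.hasFDerivAt
  have hL : HasDerivAt (fun a : ℝ => u (c + rotZ (κ * a) (y - c) + a • (EuclideanSpace.single 2 (1 : ℝ) : (EuclideanSpace ℝ (Fin 3)))))
      (fderiv ℝ u y (κ • rotGen (y - c) + (EuclideanSpace.single 2 (1 : ℝ) : (EuclideanSpace ℝ (Fin 3))))) 0 :=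
    hu'.comp_hasDerivAt (0 : ℝ) hγ
  have heq : (fun a : ℝ => u (c + rotZ (κ * a) (y - c) + a • (EuclideanSpace.single 2 (1 : ℝ) : (EuclideanSpace ℝ (Fin 3))))) =
      fun a => rotZ (κ * a) (u y) := funext fun a => hinv a y
  rw [heq] at hL
  have h := hL.unique (hasDerivAt_rotZ_mul_zero κ (u y))
  rw [add_comm] at h
  exact h

/-- **The screw component is constant on the axis**: `⟪u(c + s e₃), e₃ + κ J(s e₃)⟫ = ⟪u(c), e₃⟫`
(`J e₃ = 0` and the rotations fix the vertical component). -/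
theorem screwComponent_axis {u : (EuclideanSpace ℝ (Fin 3)) → (EuclideanSpace ℝ (Fin 3))} (κ : ℝ) (c : (EuclideanSpace ℝ (Fin 3)))
    (hinv : ∀ (a : ℝ) (y : (EuclideanSpace ℝ (Fin 3))), u (c + rotZ (κ * a) (y - c) + a • EuclideanSpace.single 2 (1 : ℝ)) =
      rotZ (κ * a) (u y)) (s : ℝ) :
    ⟪u (c + s • (EuclideanSpace.single 2 (1 : ℝ) : (EuclideanSpace ℝ (Fin 3)))),
        (EuclideanSpace.single 2 (1 : ℝ) : (EuclideanSpace ℝ (Fin 3))) + κ • rotGen (c + s • (EuclideanSpace.single 2 (1 : ℝ) : (EuclideanSpace ℝ (Fin 3))) - c)⟫_ℝ =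
      ⟪u c, (EuclideanSpace.single 2 (1 : ℝ) : (EuclideanSpace ℝ (Fin 3)))⟫_ℝ := by
  have h := hinv s c
  rw [sub_self, Gavrilov.rotZ_zero_vec, add_zero] at h
  rw [h, add_sub_cancel_left, rotGen_smul, rotGen_single_two, smul_zero, smul_zero, add_zero,
    EuclideanSpace.inner_single_right, EuclideanSpace.inner_single_right, rotZ_apply_two]

/-- **Derivative of the screw component.** `θ(z) = ⟪u(z), e₃ + κ J(z − c)⟫` is differentiable where `u` is,
with `Dθ(z)[d] = ⟪u(z), κ J d⟫ + ⟪Du(z)[d], e₃ + κ J(z − c)⟫`. -/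
theorem hasFDerivAt_screwComponent {u : (EuclideanSpace ℝ (Fin 3)) → (EuclideanSpace ℝ (Fin 3))} (κ : ℝ) (c : (EuclideanSpace ℝ (Fin 3))) {z : (EuclideanSpace ℝ (Fin 3))} (hd : DifferentiableAt ℝ u z) :
    HasFDerivAt (fun z : (EuclideanSpace ℝ (Fin 3)) => ⟪u z, (EuclideanSpace.single 2 (1 : ℝ) : (EuclideanSpace ℝ (Fin 3))) + κ • rotGen (z - c)⟫_ℝ)
      ((fderivInnerCLM ℝ (u z, (EuclideanSpace.single 2 (1 : ℝ) : (EuclideanSpace ℝ (Fin 3))) + κ • rotGen (z - c))).comp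
        ((fderiv ℝ u z).prod (κ • rotGenL))) z := by
  have h1 : HasFDerivAt (fun z : (EuclideanSpace ℝ (Fin 3)) => rotGen (z - c)) rotGenL z := by
    have : (fun z : (EuclideanSpace ℝ (Fin 3)) => rotGen (z - c)) = fun z => rotGen z - rotGen c :=
      funext fun z => map_sub rotGenL z c
    rw [this]
    exact (hasFDerivAt_rotGen z).sub_const _
  exact hd.hasFDerivAt.inner ℝ ((h1.const_smul κ).const_add _)

/-- The value of that derivative on a direction `d`. -/
theorem screwComponent_fderiv_apply (u : (EuclideanSpace ℝ (Fin 3)) → (EuclideanSpace ℝ (Fin 3))) (κ : ℝ) (c z d : (EuclideanSpace ℝ (Fin 3))) :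
    ((fderivInnerCLM ℝ (u z, (EuclideanSpace.single 2 (1 : ℝ) : (EuclideanSpace ℝ (Fin 3))) + κ • rotGen (z - c))).comp
        ((fderiv ℝ u z).prod (κ • rotGenL))) d =
      ⟪u z, κ • rotGen d⟫_ℝ + ⟪fderiv ℝ u z d, (EuclideanSpace.single 2 (1 : ℝ) : (EuclideanSpace ℝ (Fin 3))) + κ • rotGen (z - c)⟫_ℝ := by
  simp [fderivInnerCLM_apply]

/-- **Horizontal gradient of the screw component = rotated horizontal vorticity.** If
`Du(z)[e₃ + κJ(z − c)] = κ J(u(z))` (infinitesimal screw invariance) and `(curl u)(z)₂ = 0` (poloidal), then for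
every horizontal direction `d = a e₀ + b e₁`:
`⟪u(z), κ J d⟫ + ⟪Du(z)[d], e₃ + κ J(z − c)⟫ = −a ω₁(z) + b ω₀(z)`. -/
theorem screwComponent_horizontal_deriv {u : (EuclideanSpace ℝ (Fin 3)) → (EuclideanSpace ℝ (Fin 3))} (κ : ℝ) (c : (EuclideanSpace ℝ (Fin 3))) {z : (EuclideanSpace ℝ (Fin 3))}
    (hD : fderiv ℝ u z ((EuclideanSpace.single 2 (1 : ℝ) : (EuclideanSpace ℝ (Fin 3))) + κ • rotGen (z - c)) = κ • rotGen (u z))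
    (hpol : curl u z 2 = 0) (a b : ℝ) :
    ⟪u z, κ • rotGen (a • (EuclideanSpace.single 0 (1 : ℝ) : (EuclideanSpace ℝ (Fin 3))) + b • (EuclideanSpace.single 1 (1 : ℝ) : (EuclideanSpace ℝ (Fin 3))))⟫_ℝ
        + ⟪fderiv ℝ u z (a • (EuclideanSpace.single 0 (1 : ℝ) : (EuclideanSpace ℝ (Fin 3))) + b • (EuclideanSpace.single 1 (1 : ℝ) : (EuclideanSpace ℝ (Fin 3)))),
            (EuclideanSpace.single 2 (1 : ℝ) : (EuclideanSpace ℝ (Fin 3))) + κ • rotGen (z - c)⟫_ℝ =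
      a * (-(curl u z 1)) + b * curl u z 0 := by
  -- names for the nine partial derivatives `D j i = ∂ⱼ uᵢ (z)`
  set D : Fin 3 → Fin 3 → ℝ := fun j i => fderiv ℝ u z (EuclideanSpace.single j (1 : ℝ)) i with hDdef
  have hc0 : curl u z 0 = D 1 2 - D 2 1 := by simp [curl, D]
  have hc1 : curl u z 1 = D 2 0 - D 0 2 := by simp [curl, D]
  have hc2 : curl u z 2 = D 0 1 - D 1 0 := by simp [curl, D]
  -- the Killing field in the standard basis
  have hh : (EuclideanSpace.single 2 (1 : ℝ) : (EuclideanSpace ℝ (Fin 3))) + κ • rotGen (z - c) =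
      (-(κ * (z - c) 1)) • (EuclideanSpace.single 0 (1 : ℝ) : (EuclideanSpace ℝ (Fin 3))) + (κ * (z - c) 0) • (EuclideanSpace.single 1 (1 : ℝ) : (EuclideanSpace ℝ (Fin 3)))
        + (1 : ℝ) • (EuclideanSpace.single 2 (1 : ℝ) : (EuclideanSpace ℝ (Fin 3))) := by
    ext i; fin_cases i <;> simp [rotGen]; ring
  -- components of the infinitesimal invariance
  have hD' := hD
  rw [hh, map_add, map_add, map_smul, map_smul, map_smul] at hD'
  have hE0 := congrArg (fun w : (EuclideanSpace ℝ (Fin 3)) => w 0) hD'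
  have hE1 := congrArg (fun w : (EuclideanSpace ℝ (Fin 3)) => w 1) hD'
  simp only [PiLp.add_apply, PiLp.smul_apply, smul_eq_mul, rotGen_apply_zero, rotGen_apply_one] at hE0 hE1
  -- the left-hand side in coordinates
  rw [hh, map_add (fderiv ℝ u z), map_smul, map_smul, rotGen_add, rotGen_smul, rotGen_smul,
    rotGen_single_zero, rotGen_single_one, inner_eq_three, inner_eq_three]
  simp only [PiLp.add_apply, PiLp.smul_apply, PiLp.neg_apply, smul_eq_mul, PiLp.single_apply,
    Fin.isValue, ↓reduceIte, one_ne_zero, zero_ne_one, Fin.reduceEq, mul_zero, mul_one, add_zero, zero_add,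
    mul_neg]
  rw [hc0, hc1]
  rw [hc2] at hpol
  linear_combination a * hE0 + b * hE1 + (a * (κ * (z - c) 0) - b * (-(κ * (z - c) 1))) * hpol


/-- **2-D Cauchy–Schwarz for the horizontal gradient**: `|a·(−ω₁) + b·ω₀| ≤ ‖a e₀ + b e₁‖ · ‖ω‖`. -/
theorem abs_horizontal_pairing_le (a b : ℝ) (ω : (EuclideanSpace ℝ (Fin 3))) :
    |a * (-(ω 1)) + b * ω 0| ≤
      ‖a • (EuclideanSpace.single 0 (1 : ℝ) : (EuclideanSpace ℝ (Fin 3))) + b • (EuclideanSpace.single 1 (1 : ℝ) : (EuclideanSpace ℝ (Fin 3)))‖ * ‖ω‖ := by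
  have hd : ‖a • (EuclideanSpace.single 0 (1 : ℝ) : (EuclideanSpace ℝ (Fin 3))) + b • (EuclideanSpace.single 1 (1 : ℝ) : (EuclideanSpace ℝ (Fin 3)))‖ ^ 2 =
      a ^ 2 + b ^ 2 := by
    rw [SereginSverak2009.norm_sq_eq_three]
    simp
  have hω : ‖ω‖ ^ 2 = ω 0 ^ 2 + ω 1 ^ 2 + ω 2 ^ 2 := SereginSverak2009.norm_sq_eq_three ω
  have hM : 0 ≤ ‖a • (EuclideanSpace.single 0 (1 : ℝ) : (EuclideanSpace ℝ (Fin 3))) + b • (EuclideanSpace.single 1 (1 : ℝ) : (EuclideanSpace ℝ (Fin 3)))‖ * ‖ω‖ :=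
    by positivity
  have hsq : (a * (-(ω 1)) + b * ω 0) ^ 2 ≤
      (‖a • (EuclideanSpace.single 0 (1 : ℝ) : (EuclideanSpace ℝ (Fin 3))) + b • (EuclideanSpace.single 1 (1 : ℝ) : (EuclideanSpace ℝ (Fin 3)))‖ * ‖ω‖) ^ 2 := by
    rw [mul_pow, hd, hω]
    nlinarith [sq_nonneg (a * ω 0 + b * ω 1), mul_nonneg (add_nonneg (sq_nonneg a) (sq_nonneg b)) (sq_nonneg (ω 2))]
  have h := sq_le_sq.1 hsq
  rwa [abs_of_nonneg hM] at h

/-- **STUB L2 `stub_screwKinematics` (registered signature, line `slicesharp-screw` of crux K2).** A `C¹` field on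
`ℝ³` that is poloidal along `e₃` (`(curl u)₂ ≡ 0`) and invariant under the screw motions of pitch `κ` about the
vertical axis through `c` has screw component `θ = ⟪u, e₃ + κ J(· − c)⟫` with `|θ(y) − θ(c)| ≤ B ‖y − c‖` under the
vorticity bound `‖curl u‖ ≤ B` (`θ` is constant on the axis and its horizontal gradient is `(−ω₁, ω₀)`; mean value
inequality along the horizontal segment from the axis point at the height of `y`). -/
theorem stub_screwKinematics :
    ∀ (u : EuclideanSpace ℝ (Fin 3) → EuclideanSpace ℝ (Fin 3)), ContDiff ℝ 1 u →
      (∀ y, Literature.Analysis.FluidPDE.curl u y 2 = 0) →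
      ∀ (κ : ℝ) (c : EuclideanSpace ℝ (Fin 3)),
      (∀ (a : ℝ) (y : EuclideanSpace ℝ (Fin 3)),
        u (c + Literature.Analysis.FluidPDE.rotZ (κ * a) (y - c) + a • EuclideanSpace.single 2 (1 : ℝ)) =
          Literature.Analysis.FluidPDE.rotZ (κ * a) (u y)) →
      ∀ (B : ℝ), 0 ≤ B → (∀ y, ‖Literature.Analysis.FluidPDE.curl u y‖ ≤ B) →
      ∀ y, |⟪u y, (EuclideanSpace.single 2 (1 : ℝ) : EuclideanSpace ℝ (Fin 3)) + κ • Literature.Analysis.FluidPDE.rotGen (y - c)⟫_ℝ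
            - ⟪u c, (EuclideanSpace.single 2 (1 : ℝ) : EuclideanSpace ℝ (Fin 3))⟫_ℝ| ≤ B * ‖y - c‖ := by
  intro u hu hpol κ c hinv B hB hcurl y
  have hdiff : Differentiable ℝ u := hu.differentiable one_ne_zero
  -- the screw component, the axis point at the height of `y`, the horizontal offset
  set θ : (EuclideanSpace ℝ (Fin 3)) → ℝ := fun z => ⟪u z, (EuclideanSpace.single 2 (1 : ℝ) : (EuclideanSpace ℝ (Fin 3))) + κ • rotGen (z - c)⟫_ℝ with hθ
  set s₀ : ℝ := (y - c) 2 with hs₀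
  set a : ℝ := (y - c) 0 with ha
  set b : ℝ := (y - c) 1 with hb
  set y₀ : (EuclideanSpace ℝ (Fin 3)) := c + s₀ • (EuclideanSpace.single 2 (1 : ℝ) : (EuclideanSpace ℝ (Fin 3))) with hy₀
  set d : (EuclideanSpace ℝ (Fin 3)) := a • (EuclideanSpace.single 0 (1 : ℝ) : (EuclideanSpace ℝ (Fin 3))) + b • (EuclideanSpace.single 1 (1 : ℝ) : (EuclideanSpace ℝ (Fin 3))) with hd
  have hy : y₀ + d = y := by
    ext i; fin_cases i <;> simp [hy₀, hd, ha, hb, hs₀]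
  -- derivative of `θ` along the horizontal segment `s ↦ y₀ + s • d`
  set L : (EuclideanSpace ℝ (Fin 3)) → ((EuclideanSpace ℝ (Fin 3)) →L[ℝ] ℝ) := fun z =>
    (fderivInnerCLM ℝ (u z, (EuclideanSpace.single 2 (1 : ℝ) : (EuclideanSpace ℝ (Fin 3))) + κ • rotGen (z - c))).comp
      ((fderiv ℝ u z).prod (κ • rotGenL)) with hL
  have hθd : ∀ z, HasFDerivAt θ (L z) z := fun z => hasFDerivAt_screwComponent κ c (hdiff z)
  have hLd : ∀ z, L z d = a * (-(curl u z 1)) + b * curl u z 0 := fun z => by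
    rw [hL]
    simp only
    rw [screwComponent_fderiv_apply, hd]
    exact screwComponent_horizontal_deriv κ c (fderiv_screwField_eq κ c hinv (hdiff z)) (hpol z) a b
  have hg : ∀ s : ℝ, HasDerivAt (fun s : ℝ => θ (y₀ + s • d)) (L (y₀ + s • d) d) s := fun s => by
    have hc : HasDerivAt (fun s : ℝ => y₀ + s • d) d s := by
      simpa using ((hasDerivAt_id s).smul_const d).const_add y₀
    exact (hθd (y₀ + s • d)).comp_hasDerivAt s hc
  have hbound : ∀ s ∈ Ico (0 : ℝ) 1, ‖L (y₀ + s • d) d‖ ≤ B * ‖d‖ := fun s _ => by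
    rw [hLd, Real.norm_eq_abs]
    calc |a * (-(curl u (y₀ + s • d) 1)) + b * curl u (y₀ + s • d) 0|
        ≤ ‖d‖ * ‖curl u (y₀ + s • d)‖ := abs_horizontal_pairing_le a b _
      _ ≤ ‖d‖ * B := mul_le_mul_of_nonneg_left (hcurl _) (norm_nonneg _)
      _ = B * ‖d‖ := mul_comm _ _
  have hmvt := norm_image_sub_le_of_norm_deriv_le_segment_01'
    (fun s _ => (hg s).hasDerivWithinAt) hbound
  simp only [one_smul, zero_smul, add_zero] at hmvt
  rw [hy] at hmvt
  -- `θ y₀ = ⟪u c, e₃⟫` (the axis), `‖d‖ ≤ ‖y − c‖`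
  have haxis : θ y₀ = ⟪u c, (EuclideanSpace.single 2 (1 : ℝ) : (EuclideanSpace ℝ (Fin 3)))⟫_ℝ := screwComponent_axis κ c hinv s₀
  have hdn : ‖d‖ ≤ ‖y - c‖ := by
    have h1 : ‖d‖ ^ 2 ≤ ‖y - c‖ ^ 2 := by
      rw [SereginSverak2009.norm_sq_eq_three, SereginSverak2009.norm_sq_eq_three (y - c)]
      simp only [hd, ha, hb, PiLp.add_apply, PiLp.smul_apply, PiLp.single_apply, smul_eq_mul]
      simp
      nlinarith [sq_nonneg ((y - c) 2)]
    have h2 := sq_le_sq.1 h1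
    rwa [abs_of_nonneg (norm_nonneg _), abs_of_nonneg (norm_nonneg _)] at h2
  rw [haxis, Real.norm_eq_abs] at hmvt
  exact hmvt.trans (mul_le_mul_of_nonneg_left hdn hB)

end Summit.NavierStokesRegularity.NavierStokesRegularity.Theorems.PoloidalWindowDoorPoloidalWindowRigidityScrewKinematics
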